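import Summits.AtomisticToContinuum.BoseEinsteinCondensation.Theorems.BECInsertionCorrectorStaticResponseBoundTruncationCompactness
import Literature.MathematicalPhysics.QuantumManyBody.PeriodicFormSpectrum
import HarnessLib

/-!
# Degenerate ground states of the periodic `N`-body form: two orthonormal Bose-symmetric minimisers

Helper file for the stub `stub_twoMinimisersOfDegenerate` (S-C1) of line `linear-ph-floor-wagner` of the
crux `BECGroundStateSOS.PeriodicIRBound` (item stmt-AtomisticToContinuum-3972).

For `L > 0`, `N ≥ 1`, a measurable pair profile `v` with `W = ∑_{i<j} v^per(xᵢ - xⱼ) ∈ L¹` of the cell,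
`PeriodicFormSpectrum.lean` identifies `periodicGroundStateEnergy v N L = E₁ = κ₁⁻¹ - 1` and
`kyFanTwo v N L = E₁ + E₂`, `E₂ = κ₂⁻¹ - 1 ≥ E₁`, with the two top eigenpairs of the Gram operator of
the compact form embedding `ι = formEmbed : Q → L²((ℝ/ℤ)^{3N})` (`TwoModeData`). If
`kyFanTwo ≤ 2 E₁` then `E₂ = E₁` and the two `L²`-orthonormal eigenvectors `ι φ₁, ι φ₂` are both
minimisers. This file proves that every `ι x`, `x ∈ Q`, is Bose-symmetric in momentum space and that
its MAXIMAL-form energy (spectral kinetic energy `∑ₙ (2πn/L)² |⟪eₙ, ι x⟫|²` plus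
`∫ (W ∘ fromUnitTorusN) |ι x|²`) EQUALS the closed-form energy `‖x‖²_Q - ‖ι x‖²`: the gradient
components of `x` have Fourier coefficients `(2πi n_{i,k}/L) ⟪eₙ, ι x⟫` (closure of
`inner_mFourierLp_compLp_grad`) and the potential component is a.e. `√W · ι x` (closure of
`coeFn_compLp_pot_ae` along a.e.-convergent subsequences), so Parseval finishes.

References: [ReedSimonIV1978] Thm XIII.1–2 (min–max), XIII.64 (compact form embedding);
[ReedSimonI1980] §VIII.6 (closed forms).
-/

noncomputable section

namespace Summit.AtomisticToContinuum.BoseEinsteinCondensation.Cruxes.PeriodicIRBound.LinearPhFloorWagner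

open MeasureTheory Filter UnitAddTorus
open scoped ENNReal NNReal Topology InnerProductSpace
open Literature.MathematicalPhysics.QuantumManyBody
open Literature.MathematicalPhysics.QuantumManyBody.BoseGas
open Literature.Analysis.InnerProduct
open Summit.AtomisticToContinuum.BoseEinsteinCondensation.Cruxes.StaticResponseBound.UvThomsonForceWave

-- The measure on `ℝ/ℤ` is the Haar PROBABILITY measure, as in `PeriodicFormDomain.lean` (whose local
-- instances we re-activate, so that `Lp ℂ 2 volume` below is literally the target of `formEmbed`).
attribute [local instance] Literature.MathematicalPhysics.QuantumManyBody.BoseGas.formDomain_measureSpace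
  Literature.MathematicalPhysics.QuantumManyBody.BoseGas.formDomain_isProbabilityMeasure
  Literature.MathematicalPhysics.QuantumManyBody.BoseGas.formDomain_isProbabilityMeasure_pi

section FormDomain

variable {N : ℕ} {L : ℝ} {v : ℝ → ℝ≥0∞}

/-! ### Closed properties pass from the core to the form domain -/

/-- A closed property of graph-space vectors that holds on the graphs of core functions holds on the
whole form domain (the closure of the range of the graph embedding). [folklore] -/
theorem mem_of_formDomain_of_isClosed (hL : 0 < L) (hv : Measurable v)
    (hW : ∫⁻ X in cellN N L, periodicInteraction v L X ≠ ⊤)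
    {S : Set (PiLp 2 (fun _ : CompIdx N => Lp ℂ 2 (volume : Measure (UnitAddTorus (Fin N × Fin 3)))))}
    (hS : IsClosed S) (hcore : ∀ Ψ : periodicCore N L, graphEmbed hL hv hW Ψ ∈ S)
    (x : formDomain hL hv hW) :
    (x : PiLp 2 (fun _ : CompIdx N => Lp ℂ 2 (volume : Measure (UnitAddTorus (Fin N × Fin 3))))) ∈ S := by
  have hx : (x : PiLp 2 (fun _ : CompIdx N => Lp ℂ 2 (volume : Measure (UnitAddTorus (Fin N × Fin 3))))) ∈
      closure (LinearMap.range (graphEmbed hL hv hW) :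
        Set (PiLp 2 (fun _ : CompIdx N => Lp ℂ 2 (volume : Measure (UnitAddTorus (Fin N × Fin 3)))))) := by
    rw [← Submodule.topologicalClosure_coe]; exact x.2
  refine closure_minimal ?_ hS hx
  rintro _ ⟨Ψ, rfl⟩
  exact hcore Ψ

/-- **Bose symmetry in momentum space on the form domain**: the Fourier coefficients of `ι x`, `x ∈ Q`,
are invariant under permuting the particle indices of the momentum (true on the core by
`configFourierCoeff_perm`, and a closed condition). [folklore] -/
theorem inner_mFourierLp_perm_formEmbed (hL : 0 < L) (hv : Measurable v)
    (hW : ∫⁻ X in cellN N L, periodicInteraction v L X ≠ ⊤) (x : formDomain hL hv hW)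
    (σ : Equiv.Perm (Fin N)) (n : Fin N × Fin 3 → ℤ) :
    ⟪(mFourierLp 2 (fun p : Fin N × Fin 3 => n (σ p.1, p.2)) :
        Lp ℂ 2 (volume : Measure (UnitAddTorus (Fin N × Fin 3)))), formEmbed hL hv hW x⟫_ℂ =
      ⟪(mFourierLp 2 n : Lp ℂ 2 (volume : Measure (UnitAddTorus (Fin N × Fin 3)))), formEmbed hL hv hW x⟫_ℂ := by
  rw [formEmbed_apply]
  have hcont : ∀ m : Fin N × Fin 3 → ℤ, Continuous fun y : PiLp 2 (fun _ : CompIdx N =>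
      Lp ℂ 2 (volume : Measure (UnitAddTorus (Fin N × Fin 3)))) =>
        ⟪(mFourierLp 2 m : Lp ℂ 2 (volume : Measure (UnitAddTorus (Fin N × Fin 3)))), y (Sum.inl ())⟫_ℂ :=
    fun m => continuous_const.inner (PiLp.continuous_apply 2 _ (Sum.inl ()))
  refine mem_of_formDomain_of_isClosed hL hv hW (isClosed_eq (hcont _) (hcont n)) (fun Ψ => ?_) x
  show ⟪(mFourierLp 2 (fun p : Fin N × Fin 3 => n (σ p.1, p.2)) :
      Lp ℂ 2 (volume : Measure (UnitAddTorus (Fin N × Fin 3)))), graphEmbed hL hv hW Ψ (Sum.inl ())⟫_ℂ =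
    ⟪(mFourierLp 2 n : Lp ℂ 2 (volume : Measure (UnitAddTorus (Fin N × Fin 3)))), graphEmbed hL hv hW Ψ (Sum.inl ())⟫_ℂ
  rw [graphEmbed_apply, inner_mFourierLp_compLp_val, inner_mFourierLp_compLp_val,
    configFourierCoeff_perm Ψ.2.2.2]

/-- **The gradient components of a form-domain vector in momentum space**:
`⟪eₙ, x_{grad (i,k)}⟫ = (2πi n_{i,k}/L) ⟪eₙ, ι x⟫` for every `x ∈ Q` (true on the core by
`inner_mFourierLp_compLp_grad`, and a closed condition). [folklore] -/
theorem inner_mFourierLp_grad_formDomain (hL : 0 < L) (hv : Measurable v)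
    (hW : ∫⁻ X in cellN N L, periodicInteraction v L X ≠ ⊤) (x : formDomain hL hv hW)
    (n : Fin N × Fin 3 → ℤ) (p : Fin N × Fin 3) :
    ⟪(mFourierLp 2 n : Lp ℂ 2 (volume : Measure (UnitAddTorus (Fin N × Fin 3)))),
        (x : PiLp 2 (fun _ : CompIdx N => Lp ℂ 2 (volume : Measure (UnitAddTorus (Fin N × Fin 3)))))
          (Sum.inr (Sum.inl p))⟫_ℂ =
      (2 * Real.pi * Complex.I * (n p) / L) *
        ⟪(mFourierLp 2 n : Lp ℂ 2 (volume : Measure (UnitAddTorus (Fin N × Fin 3)))), formEmbed hL hv hW x⟫_ℂ := by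
  rw [formEmbed_apply]
  have hcont : ∀ c : CompIdx N, Continuous fun y : PiLp 2 (fun _ : CompIdx N =>
      Lp ℂ 2 (volume : Measure (UnitAddTorus (Fin N × Fin 3)))) =>
        ⟪(mFourierLp 2 n : Lp ℂ 2 (volume : Measure (UnitAddTorus (Fin N × Fin 3)))), y c⟫_ℂ :=
    fun c => continuous_const.inner (PiLp.continuous_apply 2 _ c)
  refine mem_of_formDomain_of_isClosed hL hv hW
    (isClosed_eq (hcont _) (continuous_const.mul (hcont (Sum.inl ())))) (fun Ψ => ?_) x
  show ⟪(mFourierLp 2 n : Lp ℂ 2 (volume : Measure (UnitAddTorus (Fin N × Fin 3)))),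
      graphEmbed hL hv hW Ψ (Sum.inr (Sum.inl p))⟫_ℂ =
    (2 * Real.pi * Complex.I * (n p) / L) *
      ⟪(mFourierLp 2 n : Lp ℂ 2 (volume : Measure (UnitAddTorus (Fin N × Fin 3)))), graphEmbed hL hv hW Ψ (Sum.inl ())⟫_ℂ
  rw [graphEmbed_apply, graphEmbed_apply]
  exact inner_mFourierLp_compLp_grad hL hv hW Ψ.2.1 Ψ.2.2.1 n p

/-- **The potential component of a form-domain vector** is a.e. `√W ∘ fromUnitTorusN` times the value
component: `x_pot = √W · ι x` a.e. for every `x ∈ Q` (true on the core by `coeFn_compLp_pot_ae`;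
passes to graph-norm limits along a.e.-convergent subsequences). [cite: ReedSimonI1980, §VIII.6] -/
theorem coeFn_pot_formDomain_ae (hL : 0 < L) (hv : Measurable v)
    (hW : ∫⁻ X in cellN N L, periodicInteraction v L X ≠ ⊤) (x : formDomain hL hv hW) :
    ∀ᵐ t ∂(volume : Measure (UnitAddTorus (Fin N × Fin 3))),
      ((x : PiLp 2 (fun _ : CompIdx N => Lp ℂ 2 (volume : Measure (UnitAddTorus (Fin N × Fin 3)))))
          (Sum.inr (Sum.inr ())) : UnitAddTorus (Fin N × Fin 3) → ℂ) t =
        ((Real.sqrt (periodicInteraction v L (fromUnitTorusN L t)).toReal : ℝ) : ℂ) *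
          (formEmbed hL hv hW x : UnitAddTorus (Fin N × Fin 3) → ℂ) t := by
  obtain ⟨Ψ, hΨ⟩ := exists_seq_tendsto_of_mem_formDomain hL hv hW x
  have hc : ∀ c : CompIdx N, Tendsto (fun j => graphEmbed hL hv hW (Ψ j) c) atTop
      (𝓝 ((x : PiLp 2 (fun _ : CompIdx N => Lp ℂ 2 (volume : Measure (UnitAddTorus (Fin N × Fin 3))))) c)) :=
    fun c => ((PiLp.continuous_apply 2 _ c).tendsto _).comp hΨ
  -- an a.e.-convergent subsequence of the value components, then of the potential components
  obtain ⟨ns, hns, hae1⟩ := (tendstoInMeasure_of_tendsto_Lp (hc (Sum.inl ()))).exists_seq_tendsto_ae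
  have hpot : Tendsto (fun j => graphEmbed hL hv hW (Ψ (ns j)) (Sum.inr (Sum.inr ()))) atTop
      (𝓝 ((x : PiLp 2 (fun _ : CompIdx N => Lp ℂ 2 (volume : Measure (UnitAddTorus (Fin N × Fin 3)))))
        (Sum.inr (Sum.inr ())))) :=
    (hc (Sum.inr (Sum.inr ()))).comp hns.tendsto_atTop
  obtain ⟨ns', hns', hae2⟩ := (tendstoInMeasure_of_tendsto_Lp hpot).exists_seq_tendsto_ae
  -- the pointwise relation between the two components of the graphs of core functions
  have hrel : ∀ᵐ t ∂(volume : Measure (UnitAddTorus (Fin N × Fin 3))), ∀ j,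
      (graphEmbed hL hv hW (Ψ j) (Sum.inr (Sum.inr ())) : UnitAddTorus (Fin N × Fin 3) → ℂ) t =
        ((Real.sqrt (periodicInteraction v L (fromUnitTorusN L t)).toReal : ℝ) : ℂ) *
          (graphEmbed hL hv hW (Ψ j) (Sum.inl ()) : UnitAddTorus (Fin N × Fin 3) → ℂ) t := by
    rw [ae_all_iff]
    intro j
    exact coeFn_compLp_pot_ae hL hv hW (Ψ j).2.1
  filter_upwards [hae1, hae2, hrel] with t ht1 ht2 ht3
  rw [formEmbed_apply]
  have hv' : Tendsto (fun j => (graphEmbed hL hv hW (Ψ (ns (ns' j))) (Sum.inl ()) :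
      UnitAddTorus (Fin N × Fin 3) → ℂ) t) atTop
      (𝓝 (((x : PiLp 2 (fun _ : CompIdx N => Lp ℂ 2 (volume : Measure (UnitAddTorus (Fin N × Fin 3)))))
        (Sum.inl ()) : UnitAddTorus (Fin N × Fin 3) → ℂ) t)) :=
    ht1.comp hns'.tendsto_atTop
  have hp' : Tendsto (fun j => (graphEmbed hL hv hW (Ψ (ns (ns' j))) (Sum.inr (Sum.inr ())) :
      UnitAddTorus (Fin N × Fin 3) → ℂ) t) atTop
      (𝓝 (((Real.sqrt (periodicInteraction v L (fromUnitTorusN L t)).toReal : ℝ) : ℂ) *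
        ((x : PiLp 2 (fun _ : CompIdx N => Lp ℂ 2 (volume : Measure (UnitAddTorus (Fin N × Fin 3)))))
          (Sum.inl ()) : UnitAddTorus (Fin N × Fin 3) → ℂ) t)) := by
    refine (hv'.const_mul ((Real.sqrt (periodicInteraction v L (fromUnitTorusN L t)).toReal : ℝ) : ℂ)).congr
      fun j => ?_
    exact (ht3 (ns (ns' j))).symm
  exact tendsto_nhds_unique ht2 hp'

/-! ### Parseval and the `L²` norm as an integral -/

/-- **Parseval in `ℝ≥0∞`** for `L²((ℝ/ℤ)^{3N})`: `∑ₙ ‖⟪eₙ, f⟫‖₊² = ‖f‖²`. [folklore] -/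
theorem tsum_nnnorm_inner_mFourierLp_sq (f : Lp ℂ 2 (volume : Measure (UnitAddTorus (Fin N × Fin 3)))) :
    ∑' n : Fin N × Fin 3 → ℤ,
        ((‖⟪(mFourierLp 2 n : Lp ℂ 2 (volume : Measure (UnitAddTorus (Fin N × Fin 3)))), f⟫_ℂ‖₊ : ℝ≥0∞)) ^ 2 =
      ENNReal.ofReal (‖f‖ ^ 2) := by
  classical
  have h := hasSum_norm_sub_sum_inner_smul_sq (mFourierBasis (d := Fin N × Fin 3)) ∅ f
  simp only [Finset.notMem_empty, if_false, Finset.sum_empty, sub_zero, coe_mFourierBasis] at h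
  simp only [coe_nnnorm_sq_eq_ofReal]
  rw [← ENNReal.ofReal_tsum_of_nonneg (fun n => by positivity) h.summable, h.tsum_eq]

/-- `∫ ‖f‖₊² = ‖f‖²` (in `ℝ≥0∞`) for `f ∈ L²`. [folklore] -/
theorem lintegral_nnnorm_sq_eq_ofReal_norm_sq {α : Type*} [MeasurableSpace α] {μ : Measure α}
    (f : Lp ℂ 2 μ) : ∫⁻ t, ((‖f t‖₊ : ℝ≥0∞)) ^ 2 ∂μ = ENNReal.ofReal (‖f‖ ^ 2) := by
  have hfin : ∫⁻ t, ((‖f t‖₊ : ℝ≥0∞)) ^ 2 ∂μ < ⊤ := by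
    have h := (Lp.memLp f).eLpNorm_lt_top
    rw [eLpNorm_lt_top_iff_lintegral_rpow_enorm_lt_top two_ne_zero ENNReal.ofNat_ne_top] at h
    simpa only [ENNReal.toReal_ofNat, enorm_rpow_two_eq_coe_nnnorm_sq] using h
  have h := norm_toLp_sq_eq_toReal_lintegral (Lp.memLp f)
  rw [Lp.toLp_coeFn] at h
  rw [h, ENNReal.ofReal_toReal hfin.ne]

/-- `W ∘ fromUnitTorusN < ∞` a.e. on the torus when `W ∈ L¹` of the cell (transport of
`ae_periodicInteraction_lt_top` along `(fromUnitTorusN L)_* dt = L^{-3N} dX|_{cell}`). [folklore] -/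
theorem ae_periodicInteraction_fromUnitTorusN_lt_top (hL : 0 < L) (hv : Measurable v)
    (hW : ∫⁻ X in cellN N L, periodicInteraction v L X ≠ ⊤) :
    ∀ᵐ t ∂(volume : Measure (UnitAddTorus (Fin N × Fin 3))),
      periodicInteraction v L (fromUnitTorusN L t) < ⊤ := by
  have h : ∀ᵐ X ∂(Measure.map (fromUnitTorusN (N := N) L) volume), periodicInteraction v L X < ⊤ := by
    rw [map_fromUnitTorusN hL]
    exact Measure.ae_smul_measure (ae_periodicInteraction_lt_top hv hW) _
  exact ae_of_ae_map (measurable_fromUnitTorusN L).aemeasurable h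

/-! ### The maximal-form energy of `ι x` is the closed-form energy `‖x‖²_Q - ‖ι x‖²` -/

/-- **The potential energy of `ι x`**: `∫ (W ∘ fromUnitTorusN) |ι x|² = ‖x_pot‖²` for `x ∈ Q`. [folklore] -/
theorem lintegral_pot_formEmbed_eq (hL : 0 < L) (hv : Measurable v)
    (hW : ∫⁻ X in cellN N L, periodicInteraction v L X ≠ ⊤) (x : formDomain hL hv hW) :
    ∫⁻ t, periodicInteraction v L (fromUnitTorusN L t) *
        (‖(formEmbed hL hv hW x : UnitAddTorus (Fin N × Fin 3) → ℂ) t‖₊ : ℝ≥0∞) ^ 2 =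
      ENNReal.ofReal (‖(x : PiLp 2 (fun _ : CompIdx N => Lp ℂ 2 (volume : Measure (UnitAddTorus (Fin N × Fin 3)))))
        (Sum.inr (Sum.inr ()))‖ ^ 2) := by
  rw [← lintegral_nnnorm_sq_eq_ofReal_norm_sq]
  refine lintegral_congr_ae ?_
  filter_upwards [coeFn_pot_formDomain_ae hL hv hW x, ae_periodicInteraction_fromUnitTorusN_lt_top hL hv hW]
    with t ht hWt
  rw [ht, nnnorm_sqrt_mul_sq_eq hWt.ne]

/-- **The spectral kinetic energy of `ι x`**: `∑ₙ (2πn/L)² |⟪eₙ, ι x⟫|² = ∑_{(i,k)} ‖x_{grad (i,k)}‖²`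
for `x ∈ Q` (Parseval, componentwise). [cite: LSSY2005, App. A (A.10)] -/
theorem tsum_kinetic_formEmbed_eq (hL : 0 < L) (hv : Measurable v)
    (hW : ∫⁻ X in cellN N L, periodicInteraction v L X ≠ ⊤) (x : formDomain hL hv hW) :
    ∑' n : Fin N × Fin 3 → ℤ, ENNReal.ofReal (∑ p, (2 * Real.pi * (n p : ℝ) / L) ^ 2) *
        (‖⟪(mFourierLp 2 n : Lp ℂ 2 (volume : Measure (UnitAddTorus (Fin N × Fin 3)))),
          formEmbed hL hv hW x⟫_ℂ‖₊ : ℝ≥0∞) ^ 2 =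
      ∑ p : Fin N × Fin 3, ENNReal.ofReal
        (‖(x : PiLp 2 (fun _ : CompIdx N => Lp ℂ 2 (volume : Measure (UnitAddTorus (Fin N × Fin 3)))))
          (Sum.inr (Sum.inl p))‖ ^ 2) := by
  have hterm : ∀ n : Fin N × Fin 3 → ℤ, ENNReal.ofReal (∑ p, (2 * Real.pi * (n p : ℝ) / L) ^ 2) *
      (‖⟪(mFourierLp 2 n : Lp ℂ 2 (volume : Measure (UnitAddTorus (Fin N × Fin 3)))),
        formEmbed hL hv hW x⟫_ℂ‖₊ : ℝ≥0∞) ^ 2 =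
      ∑ p : Fin N × Fin 3, ((‖⟪(mFourierLp 2 n : Lp ℂ 2 (volume : Measure (UnitAddTorus (Fin N × Fin 3)))),
        (x : PiLp 2 (fun _ : CompIdx N => Lp ℂ 2 (volume : Measure (UnitAddTorus (Fin N × Fin 3)))))
          (Sum.inr (Sum.inl p))⟫_ℂ‖₊ : ℝ≥0∞)) ^ 2 := fun n => by
    rw [ENNReal.ofReal_sum_of_nonneg (fun p _ => sq_nonneg _), Finset.sum_mul]
    refine Finset.sum_congr rfl fun p _ => ?_
    rw [inner_mFourierLp_grad_formDomain, nnnorm_mul, ENNReal.coe_mul, mul_pow]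
    congr 1
    have hz : (2 * Real.pi * Complex.I * (n p) / L : ℂ) = ((2 * Real.pi * (n p : ℝ) / L : ℝ) : ℂ) * Complex.I := by
      push_cast; ring
    rw [hz, coe_nnnorm_sq_eq_ofReal, norm_mul, Complex.norm_I, mul_one, Complex.norm_real, Real.norm_eq_abs,
      sq_abs]
  rw [tsum_congr hterm, Summable.tsum_finsetSum fun _ _ => ENNReal.summable]
  exact Finset.sum_congr rfl fun p _ => tsum_nnnorm_inner_mFourierLp_sq _

/-- The graph norm splits into the value, gradient and potential components:
`‖x‖²_Q = ‖ι x‖² + (∑_{(i,k)} ‖x_{grad (i,k)}‖² + ‖x_pot‖²)`. [folklore] -/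
theorem norm_sq_formDomain_eq (hL : 0 < L) (hv : Measurable v)
    (hW : ∫⁻ X in cellN N L, periodicInteraction v L X ≠ ⊤) (x : formDomain hL hv hW) :
    ‖x‖ ^ 2 = ‖formEmbed hL hv hW x‖ ^ 2 +
      (∑ p : Fin N × Fin 3, ‖(x : PiLp 2 (fun _ : CompIdx N => Lp ℂ 2 (volume : Measure (UnitAddTorus (Fin N × Fin 3)))))
          (Sum.inr (Sum.inl p))‖ ^ 2 +
        ‖(x : PiLp 2 (fun _ : CompIdx N => Lp ℂ 2 (volume : Measure (UnitAddTorus (Fin N × Fin 3)))))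
          (Sum.inr (Sum.inr ()))‖ ^ 2) := by
  rw [formEmbed_apply,
    show ‖x‖ = ‖(x : PiLp 2 (fun _ : CompIdx N => Lp ℂ 2 (volume : Measure (UnitAddTorus (Fin N × Fin 3)))))‖ from rfl,
    PiLp.norm_sq_eq_of_L2, Fintype.sum_sum_type, Fintype.sum_sum_type]
  simp only [Finset.univ_unique, Finset.sum_singleton, PUnit.default_eq_unit]

/-- **The maximal form of `ι x` equals the closed form**: for every `x` in the form domain,
`∑ₙ (2πn/L)² |⟪eₙ, ι x⟫|² + ∫ (W ∘ fromUnitTorusN) |ι x|² = ‖x‖²_Q - ‖ι x‖²` (in `ℝ≥0∞`).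
[cite: ReedSimonI1980, §VIII.6] -/
theorem maxForm_formEmbed_eq (hL : 0 < L) (hv : Measurable v)
    (hW : ∫⁻ X in cellN N L, periodicInteraction v L X ≠ ⊤) (x : formDomain hL hv hW) :
    ∑' n : Fin N × Fin 3 → ℤ, ENNReal.ofReal (∑ p, (2 * Real.pi * (n p : ℝ) / L) ^ 2) *
          (‖⟪(mFourierLp 2 n : Lp ℂ 2 (volume : Measure (UnitAddTorus (Fin N × Fin 3)))),
            formEmbed hL hv hW x⟫_ℂ‖₊ : ℝ≥0∞) ^ 2 +
        ∫⁻ t, periodicInteraction v L (fromUnitTorusN L t) *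
          (‖(formEmbed hL hv hW x : UnitAddTorus (Fin N × Fin 3) → ℂ) t‖₊ : ℝ≥0∞) ^ 2 =
      ENNReal.ofReal (‖x‖ ^ 2 - ‖formEmbed hL hv hW x‖ ^ 2) := by
  rw [tsum_kinetic_formEmbed_eq, lintegral_pot_formEmbed_eq, norm_sq_formDomain_eq hL hv hW x, add_sub_cancel_left,
    ENNReal.ofReal_add (Finset.sum_nonneg fun p _ => sq_nonneg _) (sq_nonneg _),
    ENNReal.ofReal_sum_of_nonneg fun p _ => sq_nonneg _]

end FormDomain

/-! ### Registered sub-goal S-C1 of the crux item -/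

/-- **Registered sub-goal `stub_twoMinimisersOfDegenerate`** (item stmt-AtomisticToContinuum-3972, line
`linear-ph-floor-wagner`, S-C1). If `kyFanTwo v N L ≤ 2 · periodicGroundStateEnergy v N L` for an
integrable periodic interaction, then the two lowest form eigenvalues coincide (`E₂ ≤ E₁ ≤ E₂`), and the
`L²`-orthonormal eigenvectors `ι φ₁, ι φ₂` of `PeriodicFormSpectrum.lean` are two Bose-symmetric unit
vectors whose maximal-form energies are `≤ periodicGroundStateEnergy v N L`.
[cite: ReedSimonIV1978, Thm XIII.1–2 and Thm XIII.64] -/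
theorem stub_twoMinimisersOfDegenerate :
    ∀ {N : ℕ}, 1 ≤ N → ∀ {L : ℝ} (hL : 0 < L) {v : ℝ → ℝ≥0∞} (hv : Measurable v)
      (hW : ∫⁻ X in cellN N L, periodicInteraction v L X ≠ ⊤),
      kyFanTwo v N L ≤ 2 * periodicGroundStateEnergy v N L →
      ∃ η₁ η₂ : Lp ℂ 2 (volume : Measure (UnitAddTorus (Fin N × Fin 3))),
        ‖η₁‖ = 1 ∧ ‖η₂‖ = 1 ∧ ⟪η₁, η₂⟫_ℂ = 0 ∧
        (∀ (σ : Equiv.Perm (Fin N)) (n : Fin N × Fin 3 → ℤ),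
          ⟪(mFourierLp 2 (fun p : Fin N × Fin 3 => n (σ p.1, p.2)) : Lp ℂ 2 (volume : Measure (UnitAddTorus (Fin N × Fin 3)))), η₁⟫_ℂ =
            ⟪(mFourierLp 2 n : Lp ℂ 2 (volume : Measure (UnitAddTorus (Fin N × Fin 3)))), η₁⟫_ℂ) ∧
        (∀ (σ : Equiv.Perm (Fin N)) (n : Fin N × Fin 3 → ℤ),
          ⟪(mFourierLp 2 (fun p : Fin N × Fin 3 => n (σ p.1, p.2)) : Lp ℂ 2 (volume : Measure (UnitAddTorus (Fin N × Fin 3)))), η₂⟫_ℂ =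
            ⟪(mFourierLp 2 n : Lp ℂ 2 (volume : Measure (UnitAddTorus (Fin N × Fin 3)))), η₂⟫_ℂ) ∧
        (∑' n : Fin N × Fin 3 → ℤ, ENNReal.ofReal (∑ p, (2 * Real.pi * (n p : ℝ) / L) ^ 2) *
              (‖⟪(mFourierLp 2 n : Lp ℂ 2 (volume : Measure (UnitAddTorus (Fin N × Fin 3)))), η₁⟫_ℂ‖₊ : ℝ≥0∞) ^ 2 +
            ∫⁻ t, periodicInteraction v L (fromUnitTorusN L t) *
              (‖(η₁ : UnitAddTorus (Fin N × Fin 3) → ℂ) t‖₊ : ℝ≥0∞) ^ 2) ≤ periodicGroundStateEnergy v N L ∧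
        (∑' n : Fin N × Fin 3 → ℤ, ENNReal.ofReal (∑ p, (2 * Real.pi * (n p : ℝ) / L) ^ 2) *
              (‖⟪(mFourierLp 2 n : Lp ℂ 2 (volume : Measure (UnitAddTorus (Fin N × Fin 3)))), η₂⟫_ℂ‖₊ : ℝ≥0∞) ^ 2 +
            ∫⁻ t, periodicInteraction v L (fromUnitTorusN L t) *
              (‖(η₂ : UnitAddTorus (Fin N × Fin 3) → ℂ) t‖₊ : ℝ≥0∞) ^ 2) ≤ periodicGroundStateEnergy v N L := by
  intro N hN L hL v hv hW hdeg
  obtain ⟨d⟩ := nonempty_twoModeData hL hv hW hN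
  have hE₀ := periodicGroundStateEnergy_eq_ofReal d
  have h₁ := twoModeData_one_le_inv_κ₁ d
  -- degeneracy: `E₂ ≤ E₁`, hence `κ₂⁻¹ = κ₁⁻¹`
  have hle : d.κ₁⁻¹ ≤ d.κ₂⁻¹ := (inv_le_inv₀ d.κ₁_pos d.κ₂_pos).2 d.κ₂_le_κ₁
  have hge : d.κ₂⁻¹ ≤ d.κ₁⁻¹ := by
    have h2 : (2 : ℝ≥0∞) * ENNReal.ofReal (d.κ₁⁻¹ - 1) = ENNReal.ofReal (2 * (d.κ₁⁻¹ - 1)) := by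
      rw [ENNReal.ofReal_mul zero_le_two, ENNReal.ofReal_ofNat]
    rw [kyFanTwo_eq_ofReal d, hE₀, h2, ENNReal.ofReal_le_ofReal_iff (by linarith)] at hdeg
    linarith
  have hκ : d.κ₂⁻¹ = d.κ₁⁻¹ := le_antisymm hge hle
  have hQ : ∀ x : formDomain hL hv hW, ‖formEmbed hL hv hW x‖ = 1 → ‖x‖ ^ 2 = d.κ₁⁻¹ →
      ∑' n : Fin N × Fin 3 → ℤ, ENNReal.ofReal (∑ p, (2 * Real.pi * (n p : ℝ) / L) ^ 2) *
            (‖⟪(mFourierLp 2 n : Lp ℂ 2 (volume : Measure (UnitAddTorus (Fin N × Fin 3)))),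
              formEmbed hL hv hW x⟫_ℂ‖₊ : ℝ≥0∞) ^ 2 +
          ∫⁻ t, periodicInteraction v L (fromUnitTorusN L t) *
            (‖(formEmbed hL hv hW x : UnitAddTorus (Fin N × Fin 3) → ℂ) t‖₊ : ℝ≥0∞) ^ 2 ≤
        periodicGroundStateEnergy v N L := fun x hx1 hx2 => by
    rw [maxForm_formEmbed_eq, hx1, hx2, one_pow, hE₀]
  exact ⟨formEmbed hL hv hW d.φ₁, formEmbed hL hv hW d.φ₂, d.norm_map_φ₁, d.norm_map_φ₂,
    d.inner_map_φ₁_map_φ₂, inner_mFourierLp_perm_formEmbed hL hv hW d.φ₁,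
    inner_mFourierLp_perm_formEmbed hL hv hW d.φ₂, hQ d.φ₁ d.norm_map_φ₁ d.norm_φ₁_sq,
    hQ d.φ₂ d.norm_map_φ₂ (d.norm_φ₂_sq.trans hκ)⟩

end Summit.AtomisticToContinuum.BoseEinsteinCondensation.Cruxes.PeriodicIRBound.LinearPhFloorWagner

end
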